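import Mathlib
import HarnessLib
import Summits.HubbardSuperconductivity.HubbardSuperconductivity.Theorems.KLProgrammeC4aPPKernelFarSNeg
import Summits.HubbardSuperconductivity.HubbardSuperconductivity.Theorems.KLProgrammeC4aPPKernelMidRows

/-!
# Route `KLProgramme` — crux C4a, S3 brick (B4) «(B4)-UMK1», «(U1)-M-LAW» kernel side, part 9: the comparable-levels piece `M_s` at NEGATIVE and STRIP loop levels —
# reflection `M_s(−e,−u) = M_s(e,u)` (row `hK1` for `e < 0`), the strip row `hKs1`, and the negative-level diagonal majorant `hKn1`

Cell `gate-hubbard-kl`, seat hubbard-kl-k3c3-p1 (g17; row «δμ-flow with klAngularMean constant piece»).  The box / arc / loop-circle laws for the `M` piece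
(`…NearCausticBoxMiddle`, `…GenericArcMiddle`, `…LoopCircleCanonicalMiddle`, k3c3-p3 g34/g35) ask, beyond 5b-M's rows (p709963 `ppMidKernelS_rows`), the rows at loop
levels `e ∈ [−hi, 0)` and `|e| ≤ lo`: this file supplies them for `M_s = P·(1 − κ(r̃) − κ(1−r̃))` (mid factor `≤ 1+2κ₀`, its `u`-derivative `≤ 2κ₁|r̃′|`).
* §1 `abs_midFactor_le`, `abs_midFactorD_le`, `ppSmoothRatio_neg_neg`, `ppMidKernelS_neg_neg`, `deriv_ppMidKernelS_neg_neg`,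
  **`abs_deriv_ppMidKernelS_le_abs`** (`e ≠ 0`: `|∂ᵤM_s| ≤ C₁ᴹ·(max |e| |u|)⁻¹²`);
* §2 **`abs_deriv_ppMidKernelS_strip_le`** (`|e| ≤ lo`: `≤ ((1+2κ₀)(128B₁+72) + 16κ₁)·(max lo |u|)⁻¹²`);
* §3 **`abs_deriv_ppMidKernelS_negLevel_le_majorant`**, **`abs_deriv_ppMidKernelS_negLevel_row`** (the family majorant `ρᶠ` with `κ₀ ↦ 1+2κ₀`, `κ₁ ↦ 2κ₁`).
Pure real analysis; nothing asserts (C), K3, the window or superconductivity.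
References: BGM 2006 §2.4 (2.36) [cite: BenfattoGiulianiMastropietro2006]; FST II CPAM 51 (1998) §3 [cite: FeldmanSalmhoferTrubowitz1998].
-/

noncomputable section

namespace Summit.HubbardSuperconductivity.HubbardSuperconductivity.Theorems.C4a

set_option linter.dupNamespace false -- summit = problem name (single-conjunct summit), D-0017

open Real Filter Set MeasureTheory intervalIntegral
open scoped Topology Interval
open Literature.MathematicalPhysics.QuantumLattice Literature.Analysis.SpecialFunctions

/-! ## §1 The mid factor, the reflection, row `hK1` at negative levels -/

/-- `|1 − κ(r̃) − κ(1−r̃)| ≤ 1 + 2κ₀`. [folklore] -/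
theorem abs_midFactor_le {κ : ℝ → ℝ} {κ₀ lo : ℝ} (hlo : 0 < lo) (hκb : ∀ t ∈ Icc (0 : ℝ) 1, |κ t| ≤ κ₀) (e u : ℝ) :
    |1 - κ (ppSmoothRatio lo e u) - κ (1 - ppSmoothRatio lo e u)| ≤ 1 + 2 * κ₀ := by
  have hr := ppSmoothRatio_mem_Ioo hlo e u
  have hk1 := hκb _ ⟨hr.1.le, hr.2.le⟩
  have hk2 := hκb (1 - ppSmoothRatio lo e u) ⟨by linarith [hr.2], by linarith [hr.1]⟩
  have h3 := abs_sub (1 : ℝ) (κ (ppSmoothRatio lo e u))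
  rw [abs_one] at h3
  calc |1 - κ (ppSmoothRatio lo e u) - κ (1 - ppSmoothRatio lo e u)|
      ≤ |1 - κ (ppSmoothRatio lo e u)| + |κ (1 - ppSmoothRatio lo e u)| := abs_sub _ _
    _ ≤ 1 + 2 * κ₀ := by linarith

/-- `|κ′(1−r̃) − κ′(r̃)| ≤ 2κ₁`. [folklore] -/
theorem abs_midFactorD_le {κ' : ℝ → ℝ} {κ₁ lo : ℝ} (hlo : 0 < lo) (hκ'b : ∀ t ∈ Icc (0 : ℝ) 1, |κ' t| ≤ κ₁) (e u : ℝ) :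
    |κ' (1 - ppSmoothRatio lo e u) - κ' (ppSmoothRatio lo e u)| ≤ 2 * κ₁ := by
  have hr := ppSmoothRatio_mem_Ioo hlo e u
  have hk1 := hκ'b _ ⟨hr.1.le, hr.2.le⟩
  have hk2 := hκ'b (1 - ppSmoothRatio lo e u) ⟨by linarith [hr.2], by linarith [hr.1]⟩
  calc |κ' (1 - ppSmoothRatio lo e u) - κ' (ppSmoothRatio lo e u)| ≤ |κ' (1 - ppSmoothRatio lo e u)| + |κ' (ppSmoothRatio lo e u)| := abs_sub _ _
    _ ≤ 2 * κ₁ := by linarith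

/-- `r̃(−e,−u) = r̃(e,u)`. [folklore] -/
theorem ppSmoothRatio_neg_neg (lo e u : ℝ) : ppSmoothRatio lo (-e) (-u) = ppSmoothRatio lo e u := by
  unfold ppSmoothRatio; rw [ppSmoothScale_neg, ppSmoothScale_neg]

/-- **Reflection**: `M_s(−e,−u) = M_s(e,u)` (`P(−e,−u) = P(e,u)`, `r̃` even). [folklore] -/
theorem ppMidKernelS_neg_neg (β Λ : ℝ) (κ : ℝ → ℝ) (lo e u : ℝ) : ppMidKernelS β Λ κ lo (-e) (-u) = ppMidKernelS β Λ κ lo e u := by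
  unfold ppMidKernelS; rw [ppTrueKernel_neg_neg, ppSmoothRatio_neg_neg]

/-- `∂ᵤM_s(−e,·)(u) = −∂ᵤM_s(e,·)(−u)`. [folklore] -/
theorem deriv_ppMidKernelS_neg (β Λ : ℝ) (κ : ℝ → ℝ) (lo e u : ℝ) :
    deriv (fun v : ℝ => ppMidKernelS β Λ κ lo (-e) v) u = -deriv (fun v : ℝ => ppMidKernelS β Λ κ lo e v) (-u) := by
  have h : (fun v : ℝ => ppMidKernelS β Λ κ lo (-e) v) = fun v => ppMidKernelS β Λ κ lo e (-v) := funext fun v => by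
    rw [← ppMidKernelS_neg_neg β Λ κ lo (-e) v, neg_neg]
  rw [h, deriv_comp_neg]

section NegLevels

variable {β Λ : ℝ} (hβ : 0 < β) (hΛ : 0 < Λ) {B₁ B₂ : ℝ} (hB₁ : ∀ x, |deriv salmhoferCutoff x| ≤ B₁) (hB₂ : ∀ x, |deriv (deriv salmhoferCutoff) x| ≤ B₂)
  {κ κ' : ℝ → ℝ} (hκ : ∀ t, HasDerivAt κ (κ' t) t)
  {κ₀ κ₁ : ℝ} (hκb : ∀ t ∈ Icc 0 1, |κ t| ≤ κ₀) (hκ'b : ∀ t ∈ Icc 0 1, |κ' t| ≤ κ₁)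
  {t₁ : ℝ} (ht₀ : 0 < t₁) (ht25 : t₁ ≤ 2 / 5)
  (hκs : ∀ t, t₁ ≤ t → κ t = 0) (hκ's : ∀ t, t₁ ≤ t → κ' t = 0) (hκ1 : ∀ t, t ≤ t₁ / 2 → κ t = 1) (hκ'1 : ∀ t, t ≤ t₁ / 2 → κ' t = 0)
  {lo : ℝ} (hlo : 0 < lo) (hloΛ : lo ≤ Λ)

set_option maxHeartbeats 400000 in
include hβ hΛ hB₁ hB₂ hκ hκb hκ'b ht₀ ht25 hκs hκ's hκ1 hκ'1 hlo hloΛ in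
/-- **ROW `hK1` AT EVERY NON-ZERO LOOP LEVEL**: `e ≠ 0` ⟹ `|∂ᵤM_s(e,u)| ≤ C₁ᴹ·(max |e| |u|)⁻¹²`, `C₁ᴹ = (1+2κ₀)C_P1 + 2κ₁(12B₁+9)` (p708402's positive-level row and the
reflection). [cite: BenfattoGiulianiMastropietro2006, §2.4 (2.36)] -/
theorem abs_deriv_ppMidKernelS_le_abs {e : ℝ} (he : e ≠ 0) (u : ℝ) :
    |deriv (fun v : ℝ => ppMidKernelS β Λ κ lo e v) u| ≤
      ((1 + 2 * κ₀) * (128 * B₂ + 216 * B₁ + 294 + (48 * B₁ + 28) * ((2 - t₁) / t₁)) + 2 * κ₁ * (12 * B₁ + 9)) * (max |e| |u|)⁻¹ ^ 2 := by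
  rcases he.lt_or_gt with hneg | hpos
  · have h := abs_deriv_ppMidKernelS_le hβ hΛ hB₁ hB₂ hκ hκb hκ'b ht₀ ht25 hκs hκ's hκ1 hκ'1 hlo hloΛ (neg_pos.2 hneg) (-u)
    rw [deriv_ppMidKernelS_neg, abs_neg, neg_neg, abs_neg] at h
    rwa [abs_of_neg hneg]
  · rw [abs_of_pos hpos]
    exact abs_deriv_ppMidKernelS_le hβ hΛ hB₁ hB₂ hκ hκb hκ'b ht₀ ht25 hκs hκ's hκ1 hκ'1 hlo hloΛ hpos u

/-! ## §2 Row `hKs1`: loop levels within `lo` of the Fermi level -/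

include hβ hΛ hB₁ hκ hκb hκ'b hlo hloΛ in
/-- **ROW `hKs1` FOR `M_s`**: `|e| ≤ lo` ⟹ `|∂ᵤM_s(e,u)| ≤ ((1+2κ₀)(128B₁+72) + 16κ₁)·(max lo |u|)⁻¹²` for every `u` (strip envelopes of `P`, `∂ᵤP` and
`|r̃′| ≤ 1/(m̃ₑ+m̃ᵤ) ≤ (max lo |u|)⁻¹`). [cite: BenfattoGiulianiMastropietro2006, §2.4 (2.36)] -/
theorem abs_deriv_ppMidKernelS_strip_le {e : ℝ} (he : |e| ≤ lo) (u : ℝ) :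
    |deriv (fun v : ℝ => ppMidKernelS β Λ κ lo e v) u| ≤ ((1 + 2 * κ₀) * (128 * B₁ + 72) + 16 * κ₁) * (max lo |u|)⁻¹ ^ 2 := by
  have hB0 := salmhoferB₁_nonneg hB₁
  have hκ₀ : 0 ≤ κ₀ := (abs_nonneg _).trans (hκb 0 (left_mem_Icc.2 zero_le_one))
  have hκ₁ : 0 ≤ κ₁ := (abs_nonneg _).trans (hκ'b 0 (left_mem_Icc.2 zero_le_one))
  have heΛ : |e| ≤ Λ := he.trans hloΛ
  set M : ℝ := max lo |u| with hM
  have hM0 : 0 < M := hlo.trans_le (le_max_left _ _)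
  have hMΛ : M ≤ max Λ |u| := max_le_max hloΛ le_rfl
  have hinv1 : (max Λ |u|)⁻¹ ≤ M⁻¹ := inv_anti₀ hM0 hMΛ
  have hinv2 : (max Λ |u|)⁻¹ ^ 2 ≤ M⁻¹ ^ 2 := pow_le_pow_left₀ (inv_nonneg.2 (hM0.le.trans hMΛ)) hinv1 2
  rw [(hasDerivAt_ppMidKernelS_u hβ hΛ hB₁ hκ hlo e u).deriv]
  have hk := abs_midFactor_le hlo hκb e u (κ := κ)
  have hk' := abs_midFactorD_le hlo hκ'b e u (κ' := κ')
  have hP' := (abs_ppTrueKernelDu_strip_le_inv_max_sq hβ hΛ hB₁ heΛ u).trans (mul_le_mul_of_nonneg_left hinv2 (by positivity))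
  have hP := (abs_ppTrueKernel_strip_le_inv_max hβ hΛ heΛ u).trans (mul_le_mul_of_nonneg_left hinv1 (by norm_num))
  have hr' : |-(ppSmoothScale lo e * (u / ppSmoothScale lo u)) / (ppSmoothScale lo e + ppSmoothScale lo u) ^ 2| ≤ M⁻¹ := by
    refine (abs_ppSmoothRatioD1_le hlo e u).trans ?_
    have h1 := le_ppSmoothScale hlo.le e
    have h2 := abs_le_ppSmoothScale lo u
    rw [one_div]
    refine inv_anti₀ hM0 (max_le (by linarith [ppSmoothScale_pos hlo u]) (by linarith [ppSmoothScale_pos hlo e]))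
  have hA : |ppTrueKernelDu β Λ e u * (1 - κ (ppSmoothRatio lo e u) - κ (1 - ppSmoothRatio lo e u))| ≤ (128 * B₁ + 72) * M⁻¹ ^ 2 * (1 + 2 * κ₀) := by
    rw [abs_mul]; exact mul_le_mul hP' hk (abs_nonneg _) (by positivity)
  have hB : |ppTrueKernel β Λ e u * ((κ' (1 - ppSmoothRatio lo e u) - κ' (ppSmoothRatio lo e u)) *
      (-(ppSmoothScale lo e * (u / ppSmoothScale lo u)) / (ppSmoothScale lo e + ppSmoothScale lo u) ^ 2))| ≤ 8 * M⁻¹ * (2 * κ₁ * M⁻¹) := by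
    rw [abs_mul, abs_mul]; exact mul_le_mul hP (mul_le_mul hk' hr' (abs_nonneg _) (by positivity)) (by positivity) (by positivity)
  refine ((abs_add_le _ _).trans (add_le_add hA hB)).trans (le_of_eq ?_)
  ring

end NegLevels

/-! ## §3 Row `hKn1`: the negative-level diagonal majorant -/

set_option maxHeartbeats 400000 in
/-- **ROW `hKn1` FOR THE SMOOTH COMPARABLE-LEVELS PIECE `M_s`.**  `0 < β`, `0 < Λ`, `|χ′| ≤ B₁`, `|χ″| ≤ B₂`; `|κ| ≤ κ₀`, `|κ′| ≤ κ₁` on `[0,1]`; `0 < lo ≤ s`, `s/2 ≤ u` ⟹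
`|deriv M_s(−s,·) u| ≤ ρᴹ(s)·max(u−s,lo)⁻¹²`, `ρᴹ` = the family majorant `ρᶠ` with `κ₀ ↦ 1+2κ₀`, `κ₁ ↦ 2κ₁`. [cite: BenfattoGiulianiMastropietro2006, §2.4 (2.36)] -/
theorem abs_deriv_ppMidKernelS_negLevel_le_majorant {β Λ : ℝ} (hβ : 0 < β) (hΛ : 0 < Λ) {B₁ B₂ : ℝ} (hB₁ : ∀ x, |deriv salmhoferCutoff x| ≤ B₁)
    (hB₂ : ∀ x, |deriv (deriv salmhoferCutoff) x| ≤ B₂) {κ κ' : ℝ → ℝ} {κ₀ κ₁ : ℝ} (hκ : ∀ t, HasDerivAt κ (κ' t) t)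
    (hκb : ∀ t ∈ Icc 0 1, |κ t| ≤ κ₀) (hκ'b : ∀ t ∈ Icc 0 1, |κ' t| ≤ κ₁) {lo s u : ℝ} (hlo : 0 < lo) (hs : lo ≤ s) (hu : s / 2 ≤ u) :
    |deriv (fun v : ℝ => ppMidKernelS β Λ κ lo (-s) v) u| ≤
      (64 * ((1 + 2 * κ₀) * (64 * B₂ + 120 * B₁ + 154) + (2 * κ₁) * (12 * B₁ + 9)) * Λ ^ 3 / (s + 2 * Λ) ^ 3 +
          ((1 + 2 * κ₀) * ((β * lo) ^ 2 + 2) + (2 * κ₁) * (β * lo + 1)) * Real.exp (-(β / 2 * s))) * ((max (u - s) lo)⁻¹ ^ 2) := by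
  have hB0 := salmhoferB₁_nonneg hB₁
  have hB20 : 0 ≤ B₂ := (abs_nonneg _).trans (hB₂ 0)
  have hκ₀ : 0 ≤ κ₀ := (abs_nonneg _).trans (hκb 0 (left_mem_Icc.2 zero_le_one))
  have hκ₁ : 0 ≤ κ₁ := (abs_nonneg _).trans (hκ'b 0 (left_mem_Icc.2 zero_le_one))
  have hs0 : 0 < s := hlo.trans_le hs
  have hu0 : 0 < u := by linarith
  set C : ℝ := 64 * B₂ + 120 * B₁ + 154 with hC
  have hC0 : 0 ≤ C := by rw [hC]; positivity
  set M : ℝ := max (u - s) lo with hM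
  have hMlo : lo ≤ M := le_max_right _ _
  have hM0 : 0 < M := hlo.trans_le hMlo
  rw [(hasDerivAt_ppMidKernelS_u hβ hΛ hB₁ hκ hlo (-s) u).deriv]
  -- sizes of the two profile factors
  have hr := ppSmoothRatio_mem_Ioo hlo (-s) u
  have hk : |1 - κ (ppSmoothRatio lo (-s) u) - κ (1 - ppSmoothRatio lo (-s) u)| ≤ 1 + 2 * κ₀ := abs_midFactor_le hlo hκb (-s) u
  have hκ₀' : 0 ≤ 1 + 2 * κ₀ := by positivity
  have hκ₁' : 0 ≤ 2 * κ₁ := by positivity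
  have hmaxabs : max |(-s)| |u| = max s u := by rw [abs_neg, abs_of_pos hs0, abs_of_pos hu0]
  have hS' : |(κ' (1 - ppSmoothRatio lo (-s) u) - κ' (ppSmoothRatio lo (-s) u)) *
      (-(ppSmoothScale lo (-s) * (u / ppSmoothScale lo u)) / (ppSmoothScale lo (-s) + ppSmoothScale lo u) ^ 2)| ≤ (2 * κ₁) * (max s u)⁻¹ := by
    rw [abs_mul]
    refine mul_le_mul (abs_midFactorD_le hlo hκ'b (-s) u) ?_ (abs_nonneg _) hκ₁'
    have h := (abs_ppSmoothRatioD1_le hlo (-s) u).trans (inv_ppSmoothScale_add_le_inv_max hlo (neg_ne_zero.2 hs0.ne') u)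
    rwa [hmaxabs] at h
  -- geometry: `max(u−s,lo) ≤ max(s,u)`
  have hMle : M ≤ max s u := max_le (by linarith [le_max_right s u]) (hs.trans (le_max_left _ _))
  have hsu0 : 0 < max s u := hs0.trans_le (le_max_left _ _)
  have hinvM : (max s u)⁻¹ ≤ M⁻¹ := inv_anti₀ hM0 hMle
  -- (A) the `∂ᵤP·(1−κ(r)−κ(1−r))` term: the diagonal majorant of the true kernel times `1+2κ₀`
  have hA : |ppTrueKernelDu β Λ (-s) u * (1 - κ (ppSmoothRatio lo (-s) u) - κ (1 - ppSmoothRatio lo (-s) u))| ≤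
      (1 + 2 * κ₀) * (64 * C * Λ ^ 3 / (s + 2 * Λ) ^ 3 + ((β * lo) ^ 2 + 2) * Real.exp (-(β / 2 * s))) * M⁻¹ ^ 2 := by
    have hP' := abs_ppTrueKernelDu_negLevel_le_majorant hβ hΛ hB₁ hB₂ hlo hs hu
    rw [abs_mul]
    have h0 : 0 ≤ (64 * C * Λ ^ 3 / (s + 2 * Λ) ^ 3 + ((β * lo) ^ 2 + 2) * Real.exp (-(β / 2 * s))) * M⁻¹ ^ 2 := by positivity
    calc |ppTrueKernelDu β Λ (-s) u| * |1 - κ (ppSmoothRatio lo (-s) u) - κ (1 - ppSmoothRatio lo (-s) u)|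
        ≤ (64 * C * Λ ^ 3 / (s + 2 * Λ) ^ 3 + ((β * lo) ^ 2 + 2) * Real.exp (-(β / 2 * s))) * M⁻¹ ^ 2 * (1 + 2 * κ₀) := mul_le_mul hP' hk (abs_nonneg _) h0
      _ = _ := by ring
  -- (B) the `P·(κ′(1−r)−κ′(r))·r′` term
  have hB : |ppTrueKernel β Λ (-s) u * ((κ' (1 - ppSmoothRatio lo (-s) u) - κ' (ppSmoothRatio lo (-s) u)) *
      (-(ppSmoothScale lo (-s) * (u / ppSmoothScale lo u)) / (ppSmoothScale lo (-s) + ppSmoothScale lo u) ^ 2))| ≤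
      (2 * κ₁) * (64 * (12 * B₁ + 9) * Λ ^ 3 / (s + 2 * Λ) ^ 3 + (β * lo + 1) * Real.exp (-(β / 2 * s))) * M⁻¹ ^ 2 := by
    rw [abs_mul]
    have hpow0 : 0 ≤ 64 * (12 * B₁ + 9) * Λ ^ 3 / (s + 2 * Λ) ^ 3 := by positivity
    have hexp0 : 0 ≤ (β * lo + 1) * Real.exp (-(β / 2 * s)) := by positivity
    rcases le_or_gt s (2 * Λ) with hsΛ | hsΛ
    · -- shell regime: reflected value envelope
      have hP := abs_ppTrueKernel_negLevel_le_inv_max hβ hΛ hB₁ hs0 u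
      rw [abs_of_pos hu0] at hP
      have hCle : (12 * B₁ + 9) ≤ 64 * (12 * B₁ + 9) * Λ ^ 3 / (s + 2 * Λ) ^ 3 := by
        rw [le_div_iff₀ (by positivity)]
        have h3 : (s + 2 * Λ) ^ 3 ≤ (4 * Λ) ^ 3 := pow_le_pow_left₀ (by positivity) (by linarith) 3
        nlinarith
      calc |ppTrueKernel β Λ (-s) u| * |(κ' (1 - ppSmoothRatio lo (-s) u) - κ' (ppSmoothRatio lo (-s) u)) *
            (-(ppSmoothScale lo (-s) * (u / ppSmoothScale lo u)) / (ppSmoothScale lo (-s) + ppSmoothScale lo u) ^ 2)|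
          ≤ (12 * B₁ + 9) * (max s u)⁻¹ * ((2 * κ₁) * (max s u)⁻¹) := mul_le_mul hP hS' (abs_nonneg _) (by positivity)
        _ = (2 * κ₁) * (12 * B₁ + 9) * (max s u)⁻¹ ^ 2 := by ring
        _ ≤ (2 * κ₁) * (64 * (12 * B₁ + 9) * Λ ^ 3 / (s + 2 * Λ) ^ 3) * M⁻¹ ^ 2 := by
            have h1 : (max s u)⁻¹ ^ 2 ≤ M⁻¹ ^ 2 := pow_le_pow_left₀ (inv_nonneg.2 hsu0.le) hinvM 2
            have h2 : (2 * κ₁) * (12 * B₁ + 9) ≤ (2 * κ₁) * (64 * (12 * B₁ + 9) * Λ ^ 3 / (s + 2 * Λ) ^ 3) := mul_le_mul_of_nonneg_left hCle hκ₁'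
            exact mul_le_mul h2 h1 (by positivity) (by positivity)
        _ ≤ (2 * κ₁) * (64 * (12 * B₁ + 9) * Λ ^ 3 / (s + 2 * Λ) ^ 3 + (β * lo + 1) * Real.exp (-(β / 2 * s))) * M⁻¹ ^ 2 := by
            gcongr; linarith
    · -- thermal regime
      have hsfar : Λ < s := by linarith
      rcases le_or_gt (u - s) lo with hnear | hfar
      · have hMeq : M = lo := max_eq_right hnear
        have hP := abs_ppTrueKernel_negLevel_thermal_le hβ hΛ hsΛ hu
        have hS'' : |(κ' (1 - ppSmoothRatio lo (-s) u) - κ' (ppSmoothRatio lo (-s) u)) *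
            (-(ppSmoothScale lo (-s) * (u / ppSmoothScale lo u)) / (ppSmoothScale lo (-s) + ppSmoothScale lo u) ^ 2)| ≤
            (2 * κ₁) * lo⁻¹ := hS'.trans (mul_le_mul_of_nonneg_left (inv_anti₀ hlo (hs.trans (le_max_left _ _))) hκ₁')
        rw [hMeq]
        calc |ppTrueKernel β Λ (-s) u| * |(κ' (1 - ppSmoothRatio lo (-s) u) - κ' (ppSmoothRatio lo (-s) u)) *
              (-(ppSmoothScale lo (-s) * (u / ppSmoothScale lo u)) / (ppSmoothScale lo (-s) + ppSmoothScale lo u) ^ 2)|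
            ≤ β * Real.exp (-(β / 2 * s)) * ((2 * κ₁) * lo⁻¹) := mul_le_mul hP hS'' (abs_nonneg _) (by positivity)
          _ = (2 * κ₁) * (β * lo * Real.exp (-(β / 2 * s))) * lo⁻¹ ^ 2 := by field_simp
          _ ≤ (2 * κ₁) * (64 * (12 * B₁ + 9) * Λ ^ 3 / (s + 2 * Λ) ^ 3 + (β * lo + 1) * Real.exp (-(β / 2 * s))) * lo⁻¹ ^ 2 := by
              gcongr
              nlinarith [Real.exp_pos (-(β / 2 * s))]
      · have hMeq : M = u - s := max_eq_left hfar.le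
        have hsu : s < u := by linarith
        have hP := abs_ppTrueKernel_negLevel_thermal_far_le hβ hΛ hsfar hsu
        have hexp : Real.exp (-(β * s)) ≤ Real.exp (-(β / 2 * s)) := Real.exp_le_exp.2 (by nlinarith)
        have hS'' : |(κ' (1 - ppSmoothRatio lo (-s) u) - κ' (ppSmoothRatio lo (-s) u)) *
            (-(ppSmoothScale lo (-s) * (u / ppSmoothScale lo u)) / (ppSmoothScale lo (-s) + ppSmoothScale lo u) ^ 2)| ≤
            (2 * κ₁) * (u - s)⁻¹ :=
          hS'.trans (mul_le_mul_of_nonneg_left (inv_anti₀ (by linarith) (by linarith [le_max_right s u] : u - s ≤ max s u)) hκ₁')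
        rw [hMeq]
        calc |ppTrueKernel β Λ (-s) u| * |(κ' (1 - ppSmoothRatio lo (-s) u) - κ' (ppSmoothRatio lo (-s) u)) *
              (-(ppSmoothScale lo (-s) * (u / ppSmoothScale lo u)) / (ppSmoothScale lo (-s) + ppSmoothScale lo u) ^ 2)|
            ≤ Real.exp (-(β * s)) * (u - s)⁻¹ * ((2 * κ₁) * (u - s)⁻¹) := mul_le_mul hP hS'' (abs_nonneg _) (by positivity)
          _ = (2 * κ₁) * Real.exp (-(β * s)) * (u - s)⁻¹ ^ 2 := by ring
          _ ≤ (2 * κ₁) * Real.exp (-(β / 2 * s)) * (u - s)⁻¹ ^ 2 := by gcongr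
          _ ≤ (2 * κ₁) * (64 * (12 * B₁ + 9) * Λ ^ 3 / (s + 2 * Λ) ^ 3 + (β * lo + 1) * Real.exp (-(β / 2 * s))) * (u - s)⁻¹ ^ 2 := by
              gcongr
              nlinarith [Real.exp_pos (-(β / 2 * s)), mul_pos hβ hlo]
  calc |ppTrueKernelDu β Λ (-s) u * (1 - κ (ppSmoothRatio lo (-s) u) - κ (1 - ppSmoothRatio lo (-s) u)) +
        ppTrueKernel β Λ (-s) u * ((κ' (1 - ppSmoothRatio lo (-s) u) - κ' (ppSmoothRatio lo (-s) u)) *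
          (-(ppSmoothScale lo (-s) * (u / ppSmoothScale lo u)) / (ppSmoothScale lo (-s) + ppSmoothScale lo u) ^ 2))|
      ≤ (1 + 2 * κ₀) * (64 * C * Λ ^ 3 / (s + 2 * Λ) ^ 3 + ((β * lo) ^ 2 + 2) * Real.exp (-(β / 2 * s))) * M⁻¹ ^ 2 +
          (2 * κ₁) * (64 * (12 * B₁ + 9) * Λ ^ 3 / (s + 2 * Λ) ^ 3 + (β * lo + 1) * Real.exp (-(β / 2 * s))) * M⁻¹ ^ 2 :=
        (abs_add_le _ _).trans (add_le_add hA hB)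
    _ = (64 * ((1 + 2 * κ₀) * C + (2 * κ₁) * (12 * B₁ + 9)) * Λ ^ 3 / (s + 2 * Λ) ^ 3 +
          ((1 + 2 * κ₀) * ((β * lo) ^ 2 + 2) + (2 * κ₁) * (β * lo + 1)) * Real.exp (-(β / 2 * s))) * M⁻¹ ^ 2 := by ring


/-- **ROW `hKn1` FOR `M_s` in the binder shape of `foldBox_law_rows'` / the `…Middle` laws.** [cite: BenfattoGiulianiMastropietro2006, §2.4 (2.36)] -/
theorem abs_deriv_ppMidKernelS_negLevel_row {β Λ : ℝ} (hβ : 0 < β) (hΛ : 0 < Λ) {B₁ B₂ : ℝ} (hB₁ : ∀ x, |deriv salmhoferCutoff x| ≤ B₁)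
    (hB₂ : ∀ x, |deriv (deriv salmhoferCutoff) x| ≤ B₂) {κ κ' : ℝ → ℝ} {κ₀ κ₁ : ℝ} (hκ : ∀ t, HasDerivAt κ (κ' t) t)
    (hκb : ∀ t ∈ Icc 0 1, |κ t| ≤ κ₀) (hκ'b : ∀ t ∈ Icc 0 1, |κ' t| ≤ κ₁) {lo hi : ℝ} (hlo : 0 < lo) :
    ∀ s ∈ Icc lo hi, ∀ u, s / 2 ≤ u → |deriv (fun v : ℝ => ppMidKernelS β Λ κ lo (-s) v) u| ≤
      (64 * ((1 + 2 * κ₀) * (64 * B₂ + 120 * B₁ + 154) + (2 * κ₁) * (12 * B₁ + 9)) * Λ ^ 3 / (s + 2 * Λ) ^ 3 +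
          ((1 + 2 * κ₀) * ((β * lo) ^ 2 + 2) + (2 * κ₁) * (β * lo + 1)) * Real.exp (-(β / 2 * s))) * ((max (u - s) lo)⁻¹ ^ 2) :=
  fun _ hs _ hu => abs_deriv_ppMidKernelS_negLevel_le_majorant hβ hΛ hB₁ hB₂ hκ hκb hκ'b hlo hs.1 hu

end Summit.HubbardSuperconductivity.HubbardSuperconductivity.Theorems.C4a

end
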